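import Literature.Geometry.Lorentzian.EndCompactificationTransfer
import Literature.Geometry.Lorentzian.HarmonicallyFlatDecay
import Literature.Geometry.Lorentzian.HarmonicallyFlatConformal
import Literature.Geometry.Lorentzian.CurvatureRegularity
import Literature.Geometry.Lorentzian.MassCapacityReflection
import HarnessLib

/-!
# `X ∪_e {∞}` is complete, one-ended, harmonically flat with `R ≥ 0`; Bray's Thm. 8 for two
# harmonically flat ends, modulo the positive mass theorem

Bray, J. Differential Geom. 59 (2001) 177–267, §6, proof of Thm. 8: for `(M³, ḡ)` harmonically
flat at infinity with `R ≥ 0` and the `ḡ`-harmonic `φ` of (86) (`φ → 1` in the chosen end,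
`φ → 0` in the others), *"the ends of `(M³, g̃)`, `g̃ = φ⁴ ḡ`, can be compactified … the new
compactified manifold `(M³ ∪ {∞_k}, g̃)` is a complete 3-manifold with nonnegative scalar
curvature with a single harmonically flat end. … it follows from equations (10) and (87) and the
definitions of total mass and ℰ(g) that the total mass m̃ of `(M̃³, g̃)` equals `m̄ − ℰ(ḡ)`. Then
by the Riemannian positive mass theorem [41], the total mass m̃ of `(M̃³, g̃)` is nonnegative.
Hence `m̄ ≥ ℰ(ḡ)`"* ((88)).

With the manifold `X ∪_e {∞}` (`EndCompactification.lean`), its data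
(`AFEnd.exists_compactifiedData`, `EndCompactificationData.lean`), the transferred end
(`transferEnd`, `EndCompactificationTransfer.lean`), the conformal bookkeeping
(`HarmonicallyFlatConformal.lean`) and the positive mass theorem for harmonically flat ends
modulo the PMT (`HarmonicallyFlatDecay.lean`), this file finishes the argument for a manifold
with **two** harmonically flat ends `e` (compactified) and `e₁` (kept) — the case needed for
Thm. 9, where `M̄_Σ` is the reflection double of the exterior of the horizon:

* `isCompact_compl_far_inter` — if `X` minus the far regions `e₁.far T₁`, `e.far S₀` is
  compact then so it is with any `S` in place of `S₀` (the annuli of an end are compact);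
* `Compactification.scalarCurvature_incl`, `scalarCurvature_cap` — naturality of `R` under the
  two open embeddings; `scalarCurvatureCoeff_transferEnd`,
  `isHarmonicallyFlatWith_transferEnd` — **the kept end stays harmonically flat** in
  `X ∪_e {∞}` with the same radius and factor;
* `isSoleEnd_transferEnd` — **`X ∪_e {∞}` has the single end `incl(e₁)`**: the complement of its
  far region is `incl(compact core) ∪ cap(closed ball)`;
* `scalarCurvature_nonneg_of_range_incl` — `R ≥ 0` on the dense image of `X` gives `R ≥ 0` on
  `X ∪_e {∞}` (continuity of `R`, `PseudoRiemannianMetric.contMDiff_scalarCurvature`);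
* `exists_compactified_end` — **the data of Thm. 8's proof with all its properties**: for
  `φ > 0` smooth and `h`-harmonic on `X`, `φ → 0` in `e` (positive monopole coefficient of
  `𝒰 · φ`), complete bookkeeping of `(X ∪_e {∞}, g̃)`: time-symmetric, `R ≥ 0`, `incl^* g̃ = φ⁴ h`,
  and `incl(e₁)` its only end, harmonically flat with factor `𝒰₁ · (φ ∘ Φ₁)`;
* `Bray2001_thm8_two_ends_of_positiveMass` — **Thm. 8, (88), for two harmonically flat ends,
  modulo `positive_mass_theorem_riemannian`**: if moreover `𝒰₁ = 1 + β/r + O(r⁻²)` (so the mass of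
  `e₁` is `m̄ = 2β`, Def. 2) and `φ ∘ Φ₁ = 1 − c/r + O(r⁻²)` ((87), `c = ℰ(ḡ)/2`), then
  `2c ≤ 2β`, i.e. `m̄ ≥ ℰ(ḡ)`: the mass of the single harmonically flat end of
  `(X ∪_e {∞}, φ⁴ h)` is `2β − 2c` (`hasHarmonicallyFlatMass_conformal_of_one`) and it is
  nonnegative by `AFEnd.harmonicallyFlatMass_nonneg_of_positiveMass`;
* `half_horizonCapacity_le_admEnergy_of_symmetric_of_positiveMass` — **Thm. 9 on the
  reflection-symmetric double** (`½ ℰ(Σ, h) ≤ E_ADM`, the conclusion of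
  `Bray2001_mass_ge_half_capacity` for the doubled manifold): Thm. 8 combined with (92)–(93)
  (`MassCapacityReflection.lean`), modulo the PMT and the potential (81).

Everything is proved; nothing is defined and no named fact is introduced (the positive mass
theorem enters as the hypothesis `positive_mass_theorem_riemannian`).

## References

* H. L. Bray, *Proof of the Riemannian Penrose inequality using the positive mass theorem*,
  J. Differential Geom. 59 (2001) 177–267 (arXiv:math/9911173), §2 Defs. 1–2, (10); §6 Def. 16,
  (86)–(88), Thm. 8 and its proof. [BrayRPI2001]
* B. O'Neill, *Semi-Riemannian geometry* (1983), Ch. 3, Prop. 3.59 and Def. 3.53 (naturality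
  and smoothness of the scalar curvature). [ONeill1983]
-/

noncomputable section

open Set Function Metric TopologicalSpace Filter Topology Bundle Bornology Asymptotics
open scoped Manifold ContDiff Topology

namespace Literature.Geometry.Lorentzian

open Literature.Topology.FourManifolds Literature.Geometry.Manifold

namespace AFEnd

/-! ### Compact cores of a manifold with two ends -/

section TwoEnds

variable {X : Type} [TopologicalSpace X] [ChartedSpace E3 X] (e : AFEnd X)

/-- **The closed annuli of an end are compact**: for `R < S₀`, the image under the inverse
chart of `{S₀ ≤ |z| ≤ S}` is compact in `X`. Bartnik 1986, §1 (the end is `≅ ℝ³ ∖ B_R`).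
[cite: Bartnik1986, §1] -/
theorem isCompact_dataChart_image_annulus {S₀ : ℝ} (hS₀ : e.R < S₀) (S : ℝ) :
    IsCompact (e.dataChart '' {z : exteriorRegion e.R | S₀ ≤ ‖(z : E3)‖ ∧ ‖(z : E3)‖ ≤ S}) := by
  refine IsCompact.image ?_ e.contMDiff_dataChart.continuous
  have hK : IsCompact ({x : E3 | S₀ ≤ ‖x‖} ∩ closedBall (0 : E3) S) :=
    (isCompact_closedBall (0 : E3) S).inter_left (isClosed_le continuous_const continuous_norm)
  have hsub : {x : E3 | S₀ ≤ ‖x‖} ∩ closedBall (0 : E3) S ⊆ range ((↑) : exteriorRegion e.R → E3) := by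
    intro x hx
    exact ⟨⟨x, hS₀.trans_le hx.1⟩, rfl⟩
  have hset : {z : exteriorRegion e.R | S₀ ≤ ‖(z : E3)‖ ∧ ‖(z : E3)‖ ≤ S} =
      ((↑) : exteriorRegion e.R → E3) ⁻¹' ({x : E3 | S₀ ≤ ‖x‖} ∩ closedBall (0 : E3) S) := by
    ext z
    simp only [mem_setOf_eq, preimage_inter, mem_inter_iff, mem_preimage, mem_closedBall_zero_iff]
  rw [hset]
  exact Topology.IsInducing.subtypeVal.isCompact_preimage' hK hsub

/-- The complement of a far region is covered by the complement of another far region and a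
closed annulus: `(far S)ᶜ ⊆ (far S₀)ᶜ ∪ Φ{S₀ ≤ |z| ≤ S}`. [folklore] -/
theorem compl_far_subset_union_annulus (S₀ S : ℝ) :
    (e.far S)ᶜ ⊆ (e.far S₀)ᶜ ∪
      e.dataChart '' {z : exteriorRegion e.R | S₀ ≤ ‖(z : E3)‖ ∧ ‖(z : E3)‖ ≤ S} := by
  intro q hq
  by_cases hq₀ : q ∈ e.far S₀
  · right
    obtain ⟨z, hz, rfl⟩ := e.mem_far_iff.1 hq₀
    refine ⟨z, ⟨hz.le, ?_⟩, rfl⟩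
    by_contra hzS
    exact hq (e.mem_far_iff.2 ⟨z, lt_of_not_ge hzS, rfl⟩)
  · exact Or.inl hq₀

/-- **Compact cores grow compactly**: if the complement of `e₁.far T₁ ∪ e.far S₀` is compact
(`X` has the two ends `e₁`, `e` and nothing else non-compact), then so is the complement of
`e₁.far T₁ ∪ e.far S` for every `S` when `S₀ > R` (it is a closed subset of the old core plus
a compact annulus of `e`; for `S ≤ S₀` the annulus is empty). Bray 2001, §2 ("outside a compact
set, the disjoint union of ends"). [cite: BrayRPI2001, §2 Def. 1] -/
theorem isCompact_compl_far_inter (e₁ : AFEnd X) {T₁ S₀ : ℝ} (hS₀ : e.R < S₀) (S : ℝ)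
    (hK : IsCompact ((e₁.far T₁)ᶜ ∩ (e.far S₀)ᶜ)) :
    IsCompact ((e₁.far T₁)ᶜ ∩ (e.far S)ᶜ) := by
  have hcl : IsClosed ((e₁.far T₁)ᶜ ∩ (e.far S)ᶜ) :=
    (e₁.isOpen_far T₁).isClosed_compl.inter (e.isOpen_far S).isClosed_compl
  refine (hK.union (e.isCompact_dataChart_image_annulus hS₀ S)).of_isClosed_subset hcl ?_
  rintro q ⟨hq₁, hq⟩
  rcases e.compl_far_subset_union_annulus S₀ S hq with h | h
  · exact Or.inl ⟨hq₁, h⟩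
  · exact Or.inr h

end TwoEnds

namespace Compactification

variable {X : Type} [TopologicalSpace X] [ChartedSpace E3 X] [IsManifold (𝓡 3) ∞ X]
  (e : AFEnd X) {R' : ℝ} (hR' : e.R ≤ R')

/-! ### Naturality of the scalar curvature under `incl` and `cap` -/

/-- `cap` is `C^∞` in the degree `∞ + 1` required by pullbacks of data. [folklore] -/
theorem contMDiff_cap_succ : ContMDiff (𝓡 3) (𝓡 3) (∞ + 1) (cap e hR') := contMDiff_cap e hR'

/-- The differentials of `cap` are injective. [folklore] -/
theorem mfderiv_cap_injective (y : capBall R'⁻¹) :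
    Function.Injective (mfderiv (𝓡 3) (𝓡 3) (cap e hR') y) :=
  ((e.capGlueData hR').mfderiv_inr_bijective y).1

/-- **`R(incl^* g̃)(q) = R(g̃)(incl q)`** (naturality of the scalar curvature under the open
embedding `incl`; O'Neill 1983, Ch. 3, Prop. 3.59). [cite: ONeill1983, Ch. 3, Prop. 3.59] -/
theorem scalarCurvature_incl (D' : InitialDataSet (𝓡 3) (e.Compactification hR'))
    [D'.metric.HasLeviCivita]
    [(D'.comap (incl e hR') (contMDiff_incl_succ e hR') (mfderiv_incl_injective e hR')).metric.HasLeviCivita]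
    (q : X) :
    (D'.comap (incl e hR') (contMDiff_incl_succ e hR')
        (mfderiv_incl_injective e hR')).metric.scalarCurvature q =
      D'.metric.scalarCurvature (incl e hR' q) := by
  haveI : (D'.metric.comap PseudoRiemannianMetric.contMDiff_pullbackBilin_holds (incl e hR')
      (contMDiff_incl_succ e hR') (mfderiv_incl_injective e hR') rfl).HasLeviCivita :=
    ‹(D'.comap (incl e hR') (contMDiff_incl_succ e hR')
      (mfderiv_incl_injective e hR')).metric.HasLeviCivita›
  exact D'.metric.scalarCurvature_comap PseudoRiemannianMetric.contMDiff_pullbackBilin_holds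
    (contMDiff_incl_succ e hR') (mfderiv_incl_injective e hR') rfl q

/-- **`R(cap^* g̃)(y) = R(g̃)(cap y)`** (naturality of the scalar curvature under the cap
chart; O'Neill 1983, Ch. 3, Prop. 3.59). [cite: ONeill1983, Ch. 3, Prop. 3.59] -/
theorem scalarCurvature_cap (D' : InitialDataSet (𝓡 3) (e.Compactification hR'))
    [D'.metric.HasLeviCivita]
    [(D'.comap (cap e hR') (contMDiff_cap_succ e hR') (mfderiv_cap_injective e hR')).metric.HasLeviCivita]
    (y : capBall R'⁻¹) :
    (D'.comap (cap e hR') (contMDiff_cap_succ e hR')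
        (mfderiv_cap_injective e hR')).metric.scalarCurvature y =
      D'.metric.scalarCurvature (cap e hR' y) := by
  haveI : (D'.metric.comap PseudoRiemannianMetric.contMDiff_pullbackBilin_holds (cap e hR')
      (contMDiff_cap_succ e hR') (mfderiv_cap_injective e hR') rfl).HasLeviCivita :=
    ‹(D'.comap (cap e hR') (contMDiff_cap_succ e hR')
      (mfderiv_cap_injective e hR')).metric.HasLeviCivita›
  exact D'.metric.scalarCurvature_comap PseudoRiemannianMetric.contMDiff_pullbackBilin_holds
    (contMDiff_cap_succ e hR') (mfderiv_cap_injective e hR') rfl y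

/-- **`R ≥ 0` on the image of `X` gives `R ≥ 0` on `X ∪_e {∞}`**: the scalar curvature is
continuous (`PseudoRiemannianMetric.contMDiff_scalarCurvature`) and `incl(X)` is dense
(`dense_range_incl`). This spares the flat-Laplacian computation `R(W⁴δ) = −8W⁻⁵ΔW = 0` at `∞`
of Bray's proof. [cite: BrayRPI2001, §6 proof of Thm. 8] -/
theorem scalarCurvature_nonneg_of_range_incl (D' : InitialDataSet (𝓡 3) (e.Compactification hR'))
    [D'.metric.HasLeviCivita] (h : ∀ q : X, 0 ≤ D'.metric.scalarCurvature (incl e hR' q))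
    (p : e.Compactification hR') : 0 ≤ D'.metric.scalarCurvature p := by
  have hc : Continuous D'.metric.scalarCurvature := D'.metric.contMDiff_scalarCurvature.continuous
  have hcl : IsClosed {p : e.Compactification hR' | 0 ≤ D'.metric.scalarCurvature p} :=
    isClosed_le continuous_const hc
  have hsub : range (incl e hR') ⊆ {p | 0 ≤ D'.metric.scalarCurvature p} := by
    rintro _ ⟨q, rfl⟩
    exact h q
  have huniv : closure (range (incl e hR')) ⊆ {p | 0 ≤ D'.metric.scalarCurvature p} :=
    closure_minimal hsub hcl
  exact huniv ((dense_range_incl e hR') p)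

/-! ### The kept end stays harmonically flat -/

variable (e₁ : AFEnd X) (hdisj : Disjoint (e₁.U : Set X) (e.far R'))

/-- **The scalar curvature read in the chart of the transferred end is that of `e₁` for the
pulled-back data**: `scalarCurvatureCoeff (transferEnd e₁) D' = scalarCurvatureCoeff e₁ (incl^* D')`
(the inverse chart is `incl ∘ Φ₁` and `R` is natural). [cite: ONeill1983, Ch. 3, Prop. 3.59] -/
theorem scalarCurvatureCoeff_transferEnd (D' : InitialDataSet (𝓡 3) (e.Compactification hR'))
    [D'.metric.HasLeviCivita]
    [(D'.comap (incl e hR') (contMDiff_incl_succ e hR') (mfderiv_incl_injective e hR')).metric.HasLeviCivita]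
    (x : E3) :
    scalarCurvatureCoeff (transferEnd e hR' e₁ hdisj) D' x =
      scalarCurvatureCoeff e₁ (D'.comap (incl e hR') (contMDiff_incl_succ e hR')
        (mfderiv_incl_injective e hR')) x := by
  unfold scalarCurvatureCoeff
  by_cases hx : e₁.R < ‖x‖
  · have hx' : (transferEnd e hR' e₁ hdisj).R < ‖x‖ := hx
    rw [dif_pos hx', dif_pos hx, scalarCurvature_incl]
    exact congrArg D'.metric.scalarCurvature (transferEnd_dataChart e hR' e₁ hdisj ⟨x, hx⟩)
  · have hx' : ¬ (transferEnd e hR' e₁ hdisj).R < ‖x‖ := hx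
    rw [dif_neg hx', dif_neg hx]

/-- **The kept end stays harmonically flat, for the pulled-back data** (radius and factor
unchanged): all four clauses of Def. 1 are read through `hCoeff` and `scalarCurvatureCoeff`,
which transfer (`hCoeff_transferEnd`, `scalarCurvatureCoeff_transferEnd`). Bray 2001, proof of
Thm. 8 ("a single harmonically flat end"). [cite: BrayRPI2001, §6 proof of Thm. 8] -/
theorem isHarmonicallyFlatWith_transferEnd_comap (D' : InitialDataSet (𝓡 3) (e.Compactification hR'))
    [D'.metric.HasLeviCivita]
    [(D'.comap (incl e hR') (contMDiff_incl_succ e hR') (mfderiv_incl_injective e hR')).metric.HasLeviCivita]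
    {R₁ : ℝ} {U : E3 → ℝ}
    (h : e₁.IsHarmonicallyFlatWith (D'.comap (incl e hR') (contMDiff_incl_succ e hR')
      (mfderiv_incl_injective e hR')) R₁ U) :
    (transferEnd e hR' e₁ hdisj).IsHarmonicallyFlatWith D' R₁ U := by
  refine ⟨h.le_radius, fun x hx ↦ ⟨h.pos hx, ?_, ?_⟩, h.harmonicOnNhd, h.exists_tendsto⟩
  · rw [hCoeff_transferEnd, h.hCoeff_eq hx]
  · rw [scalarCurvatureCoeff_transferEnd, h.scalarCurvatureCoeff_eq_zero hx]

/-- **The kept end stays harmonically flat** when the metric of `D'` pulls back to `h₀` under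
`incl` and `e₁` is harmonically flat for `(X, h₀)` (time-symmetric data): the transferred end is
harmonically flat for `D'` with the same radius and factor. Bray 2001, proof of Thm. 8.
[cite: BrayRPI2001, §6 proof of Thm. 8] -/
theorem isHarmonicallyFlatWith_transferEnd (D' : InitialDataSet (𝓡 3) (e.Compactification hR'))
    [D'.metric.HasLeviCivita] (D₀ : InitialDataSet (𝓡 3) X) [D₀.metric.HasLeviCivita]
    (hts' : D'.IsTimeSymmetric) (hts : D₀.IsTimeSymmetric)
    (hA : ∀ (q : X) (v w : TangentSpace (𝓡 3) q),
      D'.h.inner (incl e hR' q) (mfderiv (𝓡 3) (𝓡 3) (incl e hR') q v)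
        (mfderiv (𝓡 3) (𝓡 3) (incl e hR') q w) = D₀.h.inner q v w)
    {R₁ : ℝ} {U : E3 → ℝ} (h : e₁.IsHarmonicallyFlatWith D₀ R₁ U) :
    (transferEnd e hR' e₁ hdisj).IsHarmonicallyFlatWith D' R₁ U := by
  obtain rfl := comap_incl_eq e hR' D' D₀ hts' hts hA
  exact isHarmonicallyFlatWith_transferEnd_comap e hR' e₁ hdisj D' h

/-! ### `X ∪_e {∞}` has the single end `incl(e₁)` -/

/-- **The only end of `X ∪_e {∞}` is `incl(e₁)`** when `X` minus the far regions of `e₁` and `e`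
is compact: for `S > R'`, the complement of `incl(e₁.far T₁)` in `X ∪_e {∞}` lies in
`incl((e₁.far T₁)ᶜ ∩ (e.far S)ᶜ) ∪ cap(B̄(0, 1/S))`, a compact set — points `incl q` with
`q ∈ e.far S` and cap points `cap y`, `|y| < 1/S`, lie in the second set, the other cap points
`y ≠ 0` are `incl(capInv y)` with `|coord| ≤ S`. Bray 2001, proof of Thm. 8 ("with a single
harmonically flat end"). [cite: BrayRPI2001, §6 proof of Thm. 8] -/
theorem isSoleEnd_transferEnd {T₁ S : ℝ} (hT₁ : e₁.R < T₁) (hS : R' < S)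
    (hK : IsCompact ((e₁.far T₁)ᶜ ∩ (e.far S)ᶜ)) : (transferEnd e hR' e₁ hdisj).IsSoleEnd := by
  have hR0 : 0 < R' := e.capRadius_pos hR'
  have hS0 : 0 < S := hR0.trans hS
  -- the compact piece of the cap
  set C : Set (capBall R'⁻¹) := {y | ‖(y : E3)‖ ≤ S⁻¹} with hC_def
  have hCc : IsCompact C := by
    have hK' : IsCompact (closedBall (0 : E3) S⁻¹) := isCompact_closedBall _ _
    have hsub : closedBall (0 : E3) S⁻¹ ⊆ range ((↑) : capBall R'⁻¹ → E3) := by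
      intro y hy
      rw [mem_closedBall_zero_iff] at hy
      exact ⟨⟨y, mem_capBall.2 (hy.trans_lt (inv_strictAnti₀ hR0 hS))⟩, rfl⟩
    have hset : C = ((↑) : capBall R'⁻¹ → E3) ⁻¹' closedBall (0 : E3) S⁻¹ := by
      ext y
      simp only [hC_def, mem_setOf_eq, mem_preimage, mem_closedBall_zero_iff]
    rw [hset]
    exact Topology.IsInducing.subtypeVal.isCompact_preimage' hK' hsub
  refine ⟨T₁, hT₁, ?_⟩
  have hcl : IsClosed ((transferEnd e hR' e₁ hdisj).far T₁)ᶜ :=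
    ((transferEnd e hR' e₁ hdisj).isOpen_far T₁).isClosed_compl
  refine ((hK.image (continuous_incl e hR')).union (hCc.image (continuous_cap e hR'))).of_isClosed_subset
    hcl ?_
  intro p hp
  rw [mem_compl_iff, transferEnd_far] at hp
  obtain (⟨q, rfl⟩ | ⟨y, rfl⟩) := (e.capGlueData hR').exists_inl_or_inr p
  · -- `p = incl q`
    change incl e hR' q ∉ incl e hR' '' e₁.far T₁ at hp
    have hq₁ : q ∉ e₁.far T₁ := fun h ↦ hp ⟨q, h, rfl⟩
    by_cases hqS : q ∈ e.far S
    · -- far out in `e`: a cap point close to `∞`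
      right
      have hqR' : q ∈ e.far R' := e.far_mono hS.le hqS
      refine ⟨e.capMap hR' q, ?_, cap_capMap e hR' hqR'⟩
      show ‖(e.capMap hR' q : E3)‖ ≤ S⁻¹
      rw [e.coe_capMap_of_mem hR' hqR', norm_inversion_zero_one]
      exact (inv_strictAnti₀ hS0 (e.lt_norm_coord_of_mem_far hqS)).le
    · left
      exact ⟨q, ⟨hq₁, hqS⟩, rfl⟩
  · -- `p = cap y`
    change cap e hR' y ∉ incl e hR' '' e₁.far T₁ at hp
    by_cases hyC : ‖(y : E3)‖ ≤ S⁻¹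
    · right
      exact ⟨y, hyC, rfl⟩
    · left
      have hyS : S⁻¹ < ‖(y : E3)‖ := lt_of_not_ge hyC
      have hy0 : (y : E3) ≠ 0 := fun h ↦ by
        rw [h, norm_zero] at hyS
        exact lt_irrefl _ (hyS.trans (inv_pos.2 hS0))
      have hyR : ‖(y : E3)‖ < R'⁻¹ := mem_capBall.1 y.2
      set q : X := e.capInv y with hq_def
      have hpq : incl e hR' q = cap e hR' y := incl_capInv e hR' hy0
      have hq₁ : q ∉ e₁.far T₁ := fun h ↦ hp ⟨q, h, hpq⟩
      have hqS : q ∉ e.far S := fun h ↦ by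
        have h1 : S < ‖e.coord q‖ := e.lt_norm_coord_of_mem_far h
        rw [hq_def, e.coord_capInv hR' hy0 hyR, norm_inversion_zero_one] at h1
        have h2 : ‖(y : E3)‖⁻¹ < S := by
          have := inv_strictAnti₀ (inv_pos.2 hS0) hyS
          rwa [inv_inv] at this
        exact lt_irrefl _ (h1.trans h2)
      exact ⟨q, ⟨hq₁, hqS⟩, hpq⟩

/-! ### `R ≥ 0` and the harmonically flat structure for the data of `exists_compactifiedData` -/

/-- **`R(g̃) ≥ 0` on `X ∪_e {∞}`** when `incl^* g̃ = φ⁴ h` with `φ > 0` `h`-harmonic on `X` and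
`R(h) ≥ 0`: on `incl(X)`, `R(g̃) = R(φ⁴ h) = φ⁻⁴ R(h) ≥ 0` (Bray's (91),
`InitialDataSet.scalarCurvature_conformal_nonneg_of_dalembertian_eq_zero`, through `comap_incl_eq`
and naturality), and `incl(X)` is dense. Bray 2001, proof of Thm. 8 ("since `(M³, ḡ)` has
non-negative scalar curvature … `(M³, g̃)` has non-negative scalar curvature since `φ` is
harmonic"). [cite: BrayRPI2001, §6 proof of Thm. 8 with (91)] -/
theorem scalarCurvature_nonneg_of_conformal (D' : InitialDataSet (𝓡 3) (e.Compactification hR'))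
    [D'.metric.HasLeviCivita] (D : InitialDataSet (𝓡 3) X) [D.metric.HasLeviCivita]
    (hts' : D'.IsTimeSymmetric) (hts : D.IsTimeSymmetric)
    {φ : X → ℝ} (hφ : ContMDiff (𝓡 3) 𝓘(ℝ) ∞ φ) (hφpos : ∀ x, 0 < φ x)
    (hA : ∀ (q : X) (v w : TangentSpace (𝓡 3) q),
      D'.h.inner (incl e hR' q) (mfderiv (𝓡 3) (𝓡 3) (incl e hR') q v)
        (mfderiv (𝓡 3) (𝓡 3) (incl e hR') q w) = φ q ^ 4 * D.h.inner q v w)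
    (hΔ : ∀ x, D.metric.dalembertian φ x = 0) (hR : ∀ x, 0 ≤ D.metric.scalarCurvature x)
    (p : e.Compactification hR') : 0 ≤ D'.metric.scalarCurvature p := by
  haveI := (D.conformal φ hφ hφpos).metric.hasLeviCivita
  have htsc : (D.conformal φ hφ hφpos).IsTimeSymmetric := fun x ↦ hts x
  have hA' : ∀ (q : X) (v w : TangentSpace (𝓡 3) q),
      D'.h.inner (incl e hR' q) (mfderiv (𝓡 3) (𝓡 3) (incl e hR') q v)
        (mfderiv (𝓡 3) (𝓡 3) (incl e hR') q w) = (D.conformal φ hφ hφpos).h.inner q v w :=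
    fun q v w ↦ hA q v w
  have hc := comap_incl_eq e hR' D' (D.conformal φ hφ hφpos) hts' htsc hA'
  refine scalarCurvature_nonneg_of_range_incl e hR' D' (fun q ↦ ?_) p
  haveI := (D'.comap (incl e hR') (contMDiff_incl_succ e hR')
    (mfderiv_incl_injective e hR')).metric.hasLeviCivita
  rw [← scalarCurvature_incl e hR' D' q]
  have key : ∀ (D₀ : InitialDataSet (𝓡 3) X) [D₀.metric.HasLeviCivita],
      D₀ = D.conformal φ hφ hφpos → 0 ≤ D₀.metric.scalarCurvature q := by
    rintro D₀ _ rfl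
    exact D.scalarCurvature_conformal_nonneg_of_dalembertian_eq_zero hφ hφpos (hΔ q) (hR q)
  exact key _ hc

/-- **The kept end of `(X ∪_e {∞}, g̃)` is harmonically flat with factor `𝒰₁ · (φ ∘ Φ₁)`** when
`incl^* g̃ = φ⁴ h`, `e₁` is harmonically flat for `h` with factor `𝒰₁`, and `φ > 0` is
`h`-harmonic far out in `e₁` with a positive limit there
(`IsHarmonicallyFlatWith.conformal` transferred by `isHarmonicallyFlatWith_transferEnd`).
Bray 2001, proof of Thm. 8 ("a single harmonically flat end").
[cite: BrayRPI2001, §6 proof of Thm. 8] -/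
theorem isHarmonicallyFlatWith_transferEnd_conformal
    (D' : InitialDataSet (𝓡 3) (e.Compactification hR')) [D'.metric.HasLeviCivita]
    (D : InitialDataSet (𝓡 3) X) [D.metric.HasLeviCivita]
    (hts' : D'.IsTimeSymmetric) (hts : D.IsTimeSymmetric)
    {φ : X → ℝ} (hφ : ContMDiff (𝓡 3) 𝓘(ℝ) ∞ φ) (hφpos : ∀ x, 0 < φ x)
    (hA : ∀ (q : X) (v w : TangentSpace (𝓡 3) q),
      D'.h.inner (incl e hR' q) (mfderiv (𝓡 3) (𝓡 3) (incl e hR') q v)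
        (mfderiv (𝓡 3) (𝓡 3) (incl e hR') q w) = φ q ^ 4 * D.h.inner q v w)
    {T₁ : ℝ} {𝒰₁ : E3 → ℝ} (hHF₁ : e₁.IsHarmonicallyFlatWith D T₁ 𝒰₁) {T₂ : ℝ}
    (hΔ : ∀ y : exteriorRegion e₁.R, T₂ < ‖(y : E3)‖ →
      D.metric.dalembertian φ (e₁.dataChart y) = 0)
    {L : ℝ} (hL0 : 0 < L) (hL : TendstoAtEnd e₁ φ L) :
    (transferEnd e hR' e₁ hdisj).IsHarmonicallyFlatWith D' (max T₁ T₂)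
      (fun x ↦ 𝒰₁ x * endValue e₁ φ x) := by
  haveI := (D.conformal φ hφ hφpos).metric.hasLeviCivita
  have hconf := hHF₁.conformal hφ hφpos hΔ hL0 hL
  exact isHarmonicallyFlatWith_transferEnd e hR' e₁ hdisj D' (D.conformal φ hφ hφpos) hts'
    (fun x ↦ hts x) (fun q v w ↦ hA q v w) hconf

/-- **The total mass of the kept end is unchanged by the compactification of the other end**:
a harmonically flat mass of `e₁` for data `D₀` with `incl^* g̃ = h₀` is a harmonically flat mass
of the transferred end for `D'` (Def. 2 is read in the chart). Bray 2001, proof of Thm. 8 ("the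
total mass `m̃` of `(M̃³, g̃)`"). [cite: BrayRPI2001, §6 proof of Thm. 8 with §2 Def. 2] -/
theorem hasHarmonicallyFlatMass_transferEnd (D' : InitialDataSet (𝓡 3) (e.Compactification hR'))
    [D'.metric.HasLeviCivita] (D₀ : InitialDataSet (𝓡 3) X) [D₀.metric.HasLeviCivita]
    (hts' : D'.IsTimeSymmetric) (hts : D₀.IsTimeSymmetric)
    (hA : ∀ (q : X) (v w : TangentSpace (𝓡 3) q),
      D'.h.inner (incl e hR' q) (mfderiv (𝓡 3) (𝓡 3) (incl e hR') q v)
        (mfderiv (𝓡 3) (𝓡 3) (incl e hR') q w) = D₀.h.inner q v w)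
    {m : ℝ} (hm : e₁.HasHarmonicallyFlatMass D₀ m) :
    (transferEnd e hR' e₁ hdisj).HasHarmonicallyFlatMass D' m := by
  obtain ⟨R₁, U, a, b, hU, hexp, rfl⟩ := hm
  exact ⟨R₁, U, a, b, isHarmonicallyFlatWith_transferEnd e hR' e₁ hdisj D' D₀ hts' hts hA hU,
    hexp, rfl⟩

end Compactification

/-! ### Bray's Thm. 8 for two harmonically flat ends, modulo the positive mass theorem -/

section TheoremEight

open Compactification

variable {X : Type} [TopologicalSpace X] [ChartedSpace E3 X] [IsManifold (𝓡 3) ∞ X]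
  (e : AFEnd X)

/-- **The compactified manifold of the proof of Thm. 8, with all its properties** (two ends).
Let `D = (h, 0)` be time-symmetric data with `R(h) ≥ 0` on `X`, with harmonically flat ends `e`
(factor `𝒰`) and `e₁` (factor `𝒰₁`), `e₁.U` disjoint from `e.far S₀` and `X` minus
`e₁.far T₂ ∪ e.far S₀` compact ("outside a compact set, the disjoint union of ends"); let
`φ > 0` be smooth and `h`-harmonic on `X` with `φ → 0` in `e`, positive monopole coefficient of
`𝒰 · (φ ∘ Φ)` there, and `φ → L > 0` in `e₁`. Then for some scale `R' > S₀` there are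
time-symmetric data `D̃ = (g̃, 0)` on `X ∪_e {∞}` with `incl^* g̃ = φ⁴ h`, `R(g̃) ≥ 0`
everywhere, whose end `incl(e₁)` is harmonically flat with factor `𝒰₁ · (φ ∘ Φ₁)` and is the
only end. Bray 2001, §6, proof of Thm. 8: *"the new compactified manifold `(M³ ∪ {∞_k}, g̃)` is
a complete 3-manifold with nonnegative scalar curvature with a single harmonically flat end"*.
[cite: BrayRPI2001, §6 proof of Thm. 8] -/
theorem exists_compactified_end (D : InitialDataSet (𝓡 3) X) [D.metric.HasLeviCivita]
    (hts : D.IsTimeSymmetric) (hR : ∀ x, 0 ≤ D.metric.scalarCurvature x)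
    {R₁ : ℝ} {𝒰 : E3 → ℝ} (hHF : e.IsHarmonicallyFlatWith D R₁ 𝒰)
    (e₁ : AFEnd X) {T₁ : ℝ} {𝒰₁ : E3 → ℝ} (hHF₁ : e₁.IsHarmonicallyFlatWith D T₁ 𝒰₁)
    {S₀ : ℝ} (hS₀ : e.R < S₀) (hdisj : Disjoint (e₁.U : Set X) (e.far S₀))
    {T₂ : ℝ} (hT₂ : e₁.R < T₂) (hK : IsCompact ((e₁.far T₂)ᶜ ∩ (e.far S₀)ᶜ))
    (φ : X → ℝ) (hφ : ContMDiff (𝓡 3) 𝓘(ℝ) ∞ φ) (hφpos : ∀ x, 0 < φ x)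
    (hΔ : ∀ x, D.metric.dalembertian φ x = 0) (hφ0 : TendstoAtEnd e φ 0)
    (hb : ∀ b : ℝ, HasHarmonicExpansion (fun x ↦ 𝒰 x * endValue e φ x) 0 b → 0 < b)
    {L : ℝ} (hL0 : 0 < L) (hL : TendstoAtEnd e₁ φ L) :
    ∃ (R' : ℝ) (hR' : e.R ≤ R') (hd : Disjoint (e₁.U : Set X) (e.far R'))
      (D' : InitialDataSet (𝓡 3) (e.Compactification hR')),
      S₀ < R' ∧ D'.IsTimeSymmetric ∧
      (∀ (q : X) (v w : TangentSpace (𝓡 3) q),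
        D'.h.inner (incl e hR' q) (mfderiv (𝓡 3) (𝓡 3) (incl e hR') q v)
            (mfderiv (𝓡 3) (𝓡 3) (incl e hR') q w) = φ q ^ 4 * D.h.inner q v w) ∧
      (haveI := D'.metric.hasLeviCivita
       (∀ p, 0 ≤ D'.metric.scalarCurvature p) ∧
       (transferEnd e hR' e₁ hd).IsHarmonicallyFlatWith D' (max T₁ T₁)
         (fun x ↦ 𝒰₁ x * endValue e₁ φ x)) ∧
      (transferEnd e hR' e₁ hd).IsSoleEnd := by
  -- compactify `e` at a scale beyond `max R₁ S₀`
  obtain ⟨R', hR', W, D', -, -, hRS, -, -, hts', hA, -⟩ :=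
    e.exists_compactifiedData D (hHF.mono (le_max_left R₁ S₀)) φ hφ hφpos (R₂ := R₁)
      (fun y _ ↦ hΔ _) hφ0 hb
  have hS₀R' : S₀ < R' := lt_of_le_of_lt (le_max_right R₁ S₀) hRS
  have hd : Disjoint (e₁.U : Set X) (e.far R') := hdisj.mono_right (e.far_mono hS₀R'.le)
  haveI := D'.metric.hasLeviCivita
  refine ⟨R', hR', hd, D', hS₀R', hts', hA, ⟨?_, ?_⟩, ?_⟩
  · exact scalarCurvature_nonneg_of_conformal e hR' D' D hts' hts hφ hφpos hA hΔ hR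
  · exact isHarmonicallyFlatWith_transferEnd_conformal e hR' e₁ hd D' D hts' hts hφ hφpos hA hHF₁
      (T₂ := T₁) (fun y _ ↦ hΔ _) hL0 hL
  · exact isSoleEnd_transferEnd e hR' e₁ hd hT₂ (lt_add_one R')
      (e.isCompact_compl_far_inter e₁ hS₀ (R' + 1) hK)

/-- **Bray's Thm. 8, (88) `m̄ ≥ ℰ(ḡ)`, for a manifold with two harmonically flat ends, modulo the
Riemannian positive mass theorem.** Hypotheses: `X` a connected Hausdorff second-countable
`3`-manifold with time-symmetric data `(h, 0)`, `R(h) ≥ 0`; two harmonically flat ends, `e`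
(factor `𝒰`) and the chosen end `e₁` with factor `𝒰₁ = 1 + β/r + O(r⁻²)` (so its total mass,
Def. 2, is `m̄ = 2β`); `e₁.U` misses `e.far S₀` and the complement of `e₁.far T₂ ∪ e.far S₀` is
compact; `φ > 0` smooth with `Δ_h φ = 0` on `X` (the function of (86)), `φ → 0` in `e` with
positive monopole coefficient of `𝒰 · (φ ∘ Φ)`, and `φ ∘ Φ₁ = 1 − c/r + O(r⁻²)` in `e₁` ((87):
`c = ℰ(ḡ)/2`); and the named fact `positive_mass_theorem_riemannian` (unproved in the tree,
hence a hypothesis). Conclusion: `2c ≤ 2β`, i.e. `ℰ(ḡ) ≤ m̄`. Proof as printed: the data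
`(X ∪_e {∞}, φ⁴ h)` of `exists_compactified_end` are complete, one-ended, `R ≥ 0`, with a
harmonically flat end of total mass `m̃ = 2β − 2c` (`hasHarmonicallyFlatMass_conformal_of_one`,
"from (10) and (87)"), and `m̃ ≥ 0` by the positive mass theorem for harmonically flat ends
(`AFEnd.harmonicallyFlatMass_nonneg_of_positiveMass`).
[cite: BrayRPI2001, §6 Thm. 8 with (86)–(88) and its proof] -/
theorem Bray2001_thm8_two_ends_of_positiveMass (hPMT : positive_mass_theorem_riemannian)
    [T2Space X] [SecondCountableTopology X] [ConnectedSpace X]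
    (D : InitialDataSet (𝓡 3) X) [D.metric.HasLeviCivita] (hts : D.IsTimeSymmetric)
    (hR : ∀ x, 0 ≤ D.metric.scalarCurvature x)
    {R₁ : ℝ} {𝒰 : E3 → ℝ} (hHF : e.IsHarmonicallyFlatWith D R₁ 𝒰)
    (e₁ : AFEnd X) {T₁ : ℝ} {𝒰₁ : E3 → ℝ} (hHF₁ : e₁.IsHarmonicallyFlatWith D T₁ 𝒰₁)
    {β : ℝ} (h𝒰₁ : HasHarmonicExpansion 𝒰₁ 1 β)
    {S₀ : ℝ} (hS₀ : e.R < S₀) (hdisj : Disjoint (e₁.U : Set X) (e.far S₀))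
    {T₂ : ℝ} (hT₂ : e₁.R < T₂) (hK : IsCompact ((e₁.far T₂)ᶜ ∩ (e.far S₀)ᶜ))
    (φ : X → ℝ) (hφ : ContMDiff (𝓡 3) 𝓘(ℝ) ∞ φ) (hφpos : ∀ x, 0 < φ x)
    (hΔ : ∀ x, D.metric.dalembertian φ x = 0) (hφ0 : TendstoAtEnd e φ 0)
    (hb : ∀ b : ℝ, HasHarmonicExpansion (fun x ↦ 𝒰 x * endValue e φ x) 0 b → 0 < b)
    {c : ℝ}
    (hexp : (fun x ↦ endValue e₁ φ x - (1 - c / ‖x‖)) =O[cobounded E3] fun x ↦ ‖x‖ ^ (-2 : ℝ)) :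
    2 * c ≤ 2 * β := by
  have hφexp : HasHarmonicExpansion (endValue e₁ φ) 1 (-c) := hasHarmonicExpansion_of_sub_div hexp
  have hL : TendstoAtEnd e₁ φ 1 := hφexp.tendsto
  obtain ⟨R', hR', hd, D', -, hts', hA, hgeo, hsole⟩ :=
    e.exists_compactified_end D hts hR hHF e₁ hHF₁ hS₀ hdisj hT₂ hK φ hφ hφpos hΔ hφ0 hb
      one_pos hL
  haveI := D'.metric.hasLeviCivita
  obtain ⟨hRY, hHFY⟩ := hgeo
  haveI := (D.conformal φ hφ hφpos).metric.hasLeviCivita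
  haveI : LocallyCompactSpace X := ChartedSpace.locallyCompactSpace E3 X
  -- the mass of the kept end: `2β − 2c`
  obtain ⟨-, hm'⟩ := hHF₁.hasHarmonicallyFlatMass_conformal_of_one h𝒰₁ hφ hφpos (R₂ := T₁)
    (fun y _ ↦ hΔ _) hexp
  have hmY : (transferEnd e hR' e₁ hd).HasHarmonicallyFlatMass D' (2 * β - 2 * c) :=
    hasHarmonicallyFlatMass_transferEnd e hR' e₁ hd D' (D.conformal φ hφ hφpos) hts'
      (fun x ↦ hts x) (fun q v w ↦ hA q v w) hm'
  -- the factor of the kept end tends to `1`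
  have hlim : Tendsto (fun x ↦ 𝒰₁ x * endValue e₁ φ x) (cobounded E3) (𝓝 1) := by
    have := h𝒰₁.tendsto.mul hL
    rwa [one_mul] at this
  have h0 := AFEnd.harmonicallyFlatMass_nonneg_of_positiveMass hPMT hmY ⟨_, _, hHFY, hlim⟩ hts'
    hsole hRY
  linarith

/-- **Thm. 9 on the reflection-symmetric double, modulo the positive mass theorem and the
potential (81)** — the chain "Thm. 8 + (92)–(93)" of Bray's proof of Thm. 9 (§6: *"Then
`ℰ(ḡ) = ½ ℰ(Σ, g)`, so that theorem 9 follows from theorem 8"*), for a connected Hausdorff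
second-countable `X` with time-symmetric data, `R ≥ 0`, exactly two ends `e₁`, `e₂`, both
harmonically flat (`𝒰₁ = 1 + β/r + O(r⁻²)`), an isometry `ι` exchanging the ends and fixing the
boundary of the exterior region `V` of `e₁` pointwise, and the positive `h`-harmonic potential
`φ` of (81) (`φ → 0` in `e₂` with positive monopole coefficient of `𝒰₂ · φ`, finite energy over
`V`, `φ ∘ Φ₁ = 1 − c/r + O₁(r⁻²)`): then `½ ℰ(Σ, h) ≤ E_ADM(e₁)`. Indeed `½ ℰ(Σ, h) = 2c`
(`horizonCapacity_toReal_div_two_eq_of_harmonic_symmetric`, (92)–(93)), `2c ≤ 2β` (Thm. 8,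
`Bray2001_thm8_two_ends_of_positiveMass`) and `E_ADM(e₁) = 2β`
(`IsHarmonicallyFlatWith.hasADMEnergy`). What separates this from Thm. 9 for `(M³, g)` itself
(`Bray2001_mass_ge_half_capacity`): the construction and smoothing (94)–(103) of the double of
`M_Σ`, the harmonically flat reduction (Lemma 1), the existence of `φ`, and the positive mass
theorem. [cite: BrayRPI2001, §6 proof of Thm. 9 with Thm. 8 and (92)–(93)] -/
theorem half_horizonCapacity_le_admEnergy_of_symmetric_of_positiveMass
    (hPMT : positive_mass_theorem_riemannian)
    [T2Space X] [LocallyCompactSpace X] [SecondCountableTopology X] [ConnectedSpace X]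
    [MeasurableSpace X] [BorelSpace X]
    (D : InitialDataSet (𝓡 3) X) [D.metric.HasLeviCivita] (hts : D.IsTimeSymmetric)
    (hR : ∀ x, 0 ≤ D.metric.scalarCurvature x) {e₂ : AFEnd X}
    {T₁ : ℝ} {𝒰₁ : E3 → ℝ} (hHF₁ : e.IsHarmonicallyFlatWith D T₁ 𝒰₁)
    {β : ℝ} (h𝒰₁ : HasHarmonicExpansion 𝒰₁ 1 β)
    {R₂ : ℝ} {𝒰₂ : E3 → ℝ} (hHF₂ : e₂.IsHarmonicallyFlatWith D R₂ 𝒰₂)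
    {S₀ : ℝ} (hS₀ : e₂.R < S₀) (hdisj : Disjoint (e.U : Set X) (e₂.far S₀))
    (htwo : ∀ R₁' R₂', IsCompact (e.far R₁' ∪ e₂.far R₂')ᶜ) (ι : Diffeomorph (𝓡 3) (𝓡 3) X X ∞)
    (hiso : ∀ (x : X) (v w : TangentSpace (𝓡 3) x),
      D.h.inner (ι x) (mfderiv (𝓡 3) (𝓡 3) ι x v) (mfderiv (𝓡 3) (𝓡 3) ι x w) = D.h.inner x v w)
    (h₂₁ : ∀ (ψ : X → ℝ) (c : ℝ), TendstoAtEnd e₂ (ψ ∘ ι) c ↔ TendstoAtEnd e ψ c)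
    (h₁₂ : ∀ (ψ : X → ℝ) (c : ℝ), TendstoAtEnd e (ψ ∘ ι) c ↔ TendstoAtEnd e₂ ψ c)
    {V : Opens X} (hV : IsExteriorRegion e V) (hfix : ∀ x ∈ frontier (V : Set X), ι x = x)
    {φ : X → ℝ} (hφ : ContMDiff (𝓡 3) 𝓘(ℝ, ℝ) ∞ φ) (hφpos : ∀ x, 0 < φ x)
    (hΔ : ∀ x, D.metric.dalembertian φ x = 0) (h0 : TendstoAtEnd e₂ φ 0)
    (hb : ∀ b : ℝ, HasHarmonicExpansion (fun x ↦ 𝒰₂ x * endValue e₂ φ x) 0 b → 0 < b)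
    (hfin : ∫⁻ x in (V : Set X), ENNReal.ofReal (gradNorm D.h φ x ^ 2) ∂riemannianMeasure D.h < ⊤)
    {c : ℝ}
    (hexp : (fun x ↦ endValue e φ x - (1 - c / ‖x‖)) =O[cobounded E3] fun x ↦ ‖x‖ ^ (-2 : ℝ))
    (hexp' : (fun x : E3 ↦ ‖fderiv ℝ (fun y ↦ endValue e φ y - (1 - c / ‖y‖)) x‖)
      =O[cobounded E3] fun x ↦ ‖x‖ ^ (-3 : ℝ)) :
    (horizonCapacity D.h e V).toReal / 2 ≤ e.admEnergy D := by
  have h1 : TendstoAtEnd e φ 1 := (hasHarmonicExpansion_of_sub_div hexp).tendsto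
  have hAF : e.IsMetricAsymptoticallyFlat D 1 :=
    (hHF₁.isAsymptoticallyFlat_one h𝒰₁.tendsto hts).isMetricAsymptoticallyFlat
  obtain ⟨hcap, -⟩ := horizonCapacity_toReal_div_two_eq_of_harmonic_symmetric D one_pos hAF htwo
    ι hiso h₂₁ h₁₂ hV hfix hφ hΔ h1 h0 hfin hexp'
  have hK : IsCompact ((e.far (e.R + 1))ᶜ ∩ (e₂.far S₀)ᶜ) := by
    rw [← compl_union]
    exact htwo _ _
  have h8 := e₂.Bray2001_thm8_two_ends_of_positiveMass hPMT D hts hR hHF₂ e hHF₁ h𝒰₁ hS₀ hdisj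
    (lt_add_one e.R) hK φ hφ hφpos hΔ h0 hb hexp
  rw [hcap, (hHF₁.hasADMEnergy h𝒰₁).admEnergy_eq]
  exact h8

end TheoremEight

end AFEnd

end Literature.Geometry.Lorentzian

end
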